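import Summits.ResolutionOfSingularities.ResolutionOfSingularities.Theorems.FrobeniusLadderFRationalResolutionEquivariantStep
import Literature.Geometry.PolyhedralFans.StrictSupport
import Mathlib.LinearAlgebra.Matrix.ToLin
import HarnessLib

/-!
# Crux `FrobeniusLadder.FRationalResolution` (stmt-ResolutionOfSingularities-15317), line `redirect`,
# stub `stub_diagonalizableQuotientResolution` — SYMMETRISATION of tight strict support data on a `G`-stable fan (lane W‴, L2″)

The equivariant ladder (`…EquivariantLadder`, ✓ p831219) produces a `G`-STABLE regular refinement `Δ'` of the isolated cone.
Its consumer in lane W‴ (`…SafeRayCentreStable.map_span_centre_le_span_centre`, ✓ p830301) needs the ORDER FUNCTION of the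
projective fan to be `G`-invariant as well (`f (v ∘ π) = f v`). This file supplies the invariance by AVERAGING: if `m` is
tight strict support data on a fan `Δ` ([KempfEtAl1973] Ch. I §2 Thm. 10: cone-indexed linear pieces, each minimal exactly
on its cone) and `G` is a finite set of linear automorphisms containing `1`, closed under composition, carrying cones of `Δ`
to cones of `Δ`, then the pieces `m̃ ρ = Σ_{g ∈ G} gᵀ · m (g ρ)` are again tight strict support data, now `G`-INVARIANT
(`m̃ (h ρ) · (h x) = m̃ ρ · x`); integrality, non-negativity on a `G`-stable cone, vanishing on a `G`-stable family of cones
and positivity somewhere are inherited.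

* `vecMul_toMatrix_dotProduct` — `(w ᵀg) · u = w · (g u)`; `vecMul_toMatrix_mem_latticeN` — integrality of the pull-back;
* **`isStrictSupport_symm`** — the averaged pieces are tight strict support data;
* **`symm_dotProduct_map`** — `G`-invariance of the averaged support function;
* `symm_mem_latticeN`, `symm_nonneg`, `symm_eq_zero`, `symm_pos` — inherited properties.

Honest label: elementary linear algebra for the DESIGN W‴ (step L2″: invariant support data; the packaging with the ladder's
star list — support data tracked along the list and vanishing on the spared faces — is NOT in this file). No stub closed by
name. No definitions, no named facts, no sorry. [cite: KempfEtAl1973, Ch. I §2 Thm. 10, Ch. II §2] [folklore]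
-/

-- single-problem summit: the doubled namespace component is forced
set_option linter.dupNamespace false

namespace Summit.ResolutionOfSingularities.ResolutionOfSingularities.Theorems.FRationalResolution.InvariantSupport

open Literature.Geometry.PolyhedralFans PointedCone Finset Matrix
open Summit.ResolutionOfSingularities.ResolutionOfSingularities.Theorems.FRationalResolution.EquivariantStep

variable {κ : Type*} [Fintype κ] [DecidableEq κ]

/-- **Pull-back of a functional**: `(w ᵀg) · u = w · (g u)` for the matrix of `g`. [folklore] -/
theorem vecMul_toMatrix_dotProduct (w : κ → ℚ) (g : (κ → ℚ) →ₗ[ℚ] (κ → ℚ)) (u : κ → ℚ) :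
    (w ᵥ* LinearMap.toMatrix' g) ⬝ᵥ u = w ⬝ᵥ g u := by
  rw [← dotProduct_mulVec, LinearMap.toMatrix'_mulVec]

omit [DecidableEq κ] in
/-- The dot product of two lattice vectors is an integer. [folklore] -/
theorem exists_int_dotProduct {w x : κ → ℚ} (hw : w ∈ latticeN κ) (hx : x ∈ latticeN κ) :
    ∃ z : ℤ, w ⬝ᵥ x = z := by
  rw [mem_latticeN_iff] at hw hx
  choose a ha using hw
  choose b hb using hx
  refine ⟨∑ i, a i * b i, ?_⟩
  simp only [dotProduct, ha, hb, Int.cast_sum, Int.cast_mul]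

/-- **The pull-back of an integral functional along a lattice-preserving map is integral.** [folklore] -/
theorem vecMul_toMatrix_mem_latticeN {w : κ → ℚ} (hw : w ∈ latticeN κ) (g : (κ → ℚ) →ₗ[ℚ] (κ → ℚ))
    (hg : ∀ x ∈ latticeN κ, g x ∈ latticeN κ) : w ᵥ* LinearMap.toMatrix' g ∈ latticeN κ := by
  rw [mem_latticeN_iff]
  intro j
  have hcol : g (Pi.single j 1) ∈ latticeN κ := by
    refine hg _ (mem_latticeN_iff.mpr fun i => ⟨if i = j then 1 else 0, ?_⟩)
    by_cases h : i = j
    · subst h; simp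
    · simp [h]
  obtain ⟨z, hz⟩ := exists_int_dotProduct hw hcol
  refine ⟨z, ?_⟩
  rw [← hz]
  simp only [vecMul, dotProduct, LinearMap.toMatrix'_apply]

section Symm

variable {Δ : Fan ℚ (κ → ℚ)} {G : Set ((κ → ℚ) ≃ₗ[ℚ] (κ → ℚ))} (hGfin : G.Finite)
  {m : PointedCone ℚ (κ → ℚ) → (κ → ℚ)}

/-- The averaged piece paired with `u` is the sum of the pieces of the transported cones at the transported points.
[cite: KempfEtAl1973, Ch. II §2] -/
theorem symm_dotProduct (ρ : PointedCone ℚ (κ → ℚ)) (u : κ → ℚ) :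
    (∑ g ∈ hGfin.toFinset, m (ρ.map (g : (κ → ℚ) →ₗ[ℚ] (κ → ℚ))) ᵥ* LinearMap.toMatrix' (g : (κ → ℚ) →ₗ[ℚ] (κ → ℚ)))
        ⬝ᵥ u =
      ∑ g ∈ hGfin.toFinset, m (ρ.map (g : (κ → ℚ) →ₗ[ℚ] (κ → ℚ))) ⬝ᵥ g u := by
  rw [sum_dotProduct]
  refine Finset.sum_congr rfl fun g _ => ?_
  rw [vecMul_toMatrix_dotProduct]
  rfl

/-- **Averaging preserves tight strict support data.** If `m` is tight strict support data on `Δ` and the finite set `G`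
of linear automorphisms contains `1` and carries cones of `Δ` to cones of `Δ`, then so is `ρ ↦ Σ_{g ∈ G} gᵀ · m (g ρ)`
(each summand is tight strict support data for the transported fan `= Δ`; a sum of such is again one).
[cite: KempfEtAl1973, Ch. I §2 Thm. 10] -/
theorem isStrictSupport_symm (hG1 : LinearEquiv.refl ℚ (κ → ℚ) ∈ G)
    (hGΔ : ∀ g ∈ G, ∀ ρ ∈ Δ.cones, ρ.map (g : (κ → ℚ) →ₗ[ℚ] (κ → ℚ)) ∈ Δ.cones) (hm : Δ.IsStrictSupport m) :
    Δ.IsStrictSupport fun ρ =>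
      ∑ g ∈ hGfin.toFinset, m (ρ.map (g : (κ → ℚ) →ₗ[ℚ] (κ → ℚ))) ᵥ* LinearMap.toMatrix' (g : (κ → ℚ) →ₗ[ℚ] (κ → ℚ)) := by
  intro ρ hρ ρ' hρ' u hu
  simp only [symm_dotProduct]
  have hterm : ∀ g ∈ hGfin.toFinset,
      m (ρ'.map (g : (κ → ℚ) →ₗ[ℚ] (κ → ℚ))) ⬝ᵥ g u ≤ m (ρ.map (g : (κ → ℚ) →ₗ[ℚ] (κ → ℚ))) ⬝ᵥ g u := by
    intro g hg
    have hg' : g ∈ G := hGfin.mem_toFinset.mp hg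
    have hgu : g u ∈ ρ'.map (g : (κ → ℚ) →ₗ[ℚ] (κ → ℚ)) := PointedCone.mem_map.mpr ⟨u, hu, rfl⟩
    exact (hm (hGΔ g hg' ρ hρ) (hGΔ g hg' ρ' hρ') hgu).1
  refine ⟨Finset.sum_le_sum hterm, fun heq => ?_⟩
  have hall := (Finset.sum_eq_sum_iff_of_le hterm).mp heq
  have h1 : LinearEquiv.refl ℚ (κ → ℚ) ∈ hGfin.toFinset := hGfin.mem_toFinset.mpr hG1
  have hone := hall _ h1
  have hρ1 : ρ.map ((LinearEquiv.refl ℚ (κ → ℚ) : (κ → ℚ) ≃ₗ[ℚ] (κ → ℚ)) : (κ → ℚ) →ₗ[ℚ] (κ → ℚ)) = ρ := by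
    ext x; simp
  have hρ'1 : ρ'.map ((LinearEquiv.refl ℚ (κ → ℚ) : (κ → ℚ) ≃ₗ[ℚ] (κ → ℚ)) : (κ → ℚ) →ₗ[ℚ] (κ → ℚ)) = ρ' := by
    ext x; simp
  rw [hρ1, hρ'1] at hone
  exact (hm hρ hρ' hu).2 (by simpa using hone)

/-- **The averaged support function is `G`-invariant**: for `h ∈ G` (with `G` closed under composition and inverses),
`m̃ (h ρ) · (h x) = m̃ ρ · x` (reindex the sum by `g ↦ h ≫ g`). [cite: KempfEtAl1973, Ch. II §2] -/
theorem symm_dotProduct_map (hGsymm : ∀ g ∈ G, g.symm ∈ G) (hGtrans : ∀ g ∈ G, ∀ h ∈ G, g.trans h ∈ G)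
    {h : (κ → ℚ) ≃ₗ[ℚ] (κ → ℚ)} (hh : h ∈ G) (ρ : PointedCone ℚ (κ → ℚ)) (x : κ → ℚ) :
    (∑ g ∈ hGfin.toFinset, m ((ρ.map (h : (κ → ℚ) →ₗ[ℚ] (κ → ℚ))).map (g : (κ → ℚ) →ₗ[ℚ] (κ → ℚ))) ᵥ*
        LinearMap.toMatrix' (g : (κ → ℚ) →ₗ[ℚ] (κ → ℚ))) ⬝ᵥ h x =
      (∑ g ∈ hGfin.toFinset, m (ρ.map (g : (κ → ℚ) →ₗ[ℚ] (κ → ℚ))) ᵥ* LinearMap.toMatrix' (g : (κ → ℚ) →ₗ[ℚ] (κ → ℚ)))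
        ⬝ᵥ x := by
  rw [symm_dotProduct, symm_dotProduct]
  -- reindex by `g ↦ h.trans g`
  let e : ((κ → ℚ) ≃ₗ[ℚ] (κ → ℚ)) ≃ ((κ → ℚ) ≃ₗ[ℚ] (κ → ℚ)) :=
    { toFun := fun g => h.trans g
      invFun := fun g => h.symm.trans g
      left_inv := fun g => by ext y; simp
      right_inv := fun g => by ext y; simp }
  refine Finset.sum_equiv e (fun g => ?_) (fun g _ => ?_)
  · constructor
    · intro hg
      exact hGfin.mem_toFinset.mpr (hGtrans h hh g (hGfin.mem_toFinset.mp hg))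
    · intro hg
      have hmem : h.symm.trans (h.trans g) ∈ G := hGtrans _ (hGsymm h hh) _ (hGfin.mem_toFinset.mp hg)
      have heq : h.symm.trans (h.trans g) = g := by ext y; simp
      rw [heq] at hmem
      exact hGfin.mem_toFinset.mpr hmem
  · change m ((ρ.map (h : (κ → ℚ) →ₗ[ℚ] (κ → ℚ))).map (g : (κ → ℚ) →ₗ[ℚ] (κ → ℚ))) ⬝ᵥ g (h x) =
      m (ρ.map ((h.trans g : (κ → ℚ) ≃ₗ[ℚ] (κ → ℚ)) : (κ → ℚ) →ₗ[ℚ] (κ → ℚ))) ⬝ᵥ (h.trans g) x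
    rw [map_map_trans, LinearEquiv.trans_apply]

/-- **Integrality is inherited**: if every piece is a lattice vector and every `g ∈ G` preserves the lattice, the
averaged pieces are lattice vectors. [folklore] -/
theorem symm_mem_latticeN (hGN : ∀ g ∈ G, ∀ x ∈ latticeN κ, g x ∈ latticeN κ)
    (hGΔ : ∀ g ∈ G, ∀ ρ ∈ Δ.cones, ρ.map (g : (κ → ℚ) →ₗ[ℚ] (κ → ℚ)) ∈ Δ.cones)
    (hmN : ∀ ρ ∈ Δ.cones, m ρ ∈ latticeN κ) {ρ : PointedCone ℚ (κ → ℚ)} (hρ : ρ ∈ Δ.cones) :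
    ∑ g ∈ hGfin.toFinset, m (ρ.map (g : (κ → ℚ) →ₗ[ℚ] (κ → ℚ))) ᵥ* LinearMap.toMatrix' (g : (κ → ℚ) →ₗ[ℚ] (κ → ℚ)) ∈
      latticeN κ := by
  refine Submodule.sum_mem _ fun g hg => ?_
  have hg' : g ∈ G := hGfin.mem_toFinset.mp hg
  exact vecMul_toMatrix_mem_latticeN (hmN _ (hGΔ g hg' ρ hρ)) _ fun x hx => by simpa using hGN g hg' x hx

/-- **Non-negativity on a `G`-stable cone is inherited.** [folklore] -/
theorem symm_nonneg {σ : PointedCone ℚ (κ → ℚ)} (hGσ : ∀ g ∈ G, ∀ x ∈ σ, g x ∈ σ)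
    (hGΔ : ∀ g ∈ G, ∀ ρ ∈ Δ.cones, ρ.map (g : (κ → ℚ) →ₗ[ℚ] (κ → ℚ)) ∈ Δ.cones)
    (hnn : ∀ ρ ∈ Δ.cones, ∀ x ∈ σ, 0 ≤ m ρ ⬝ᵥ x) {ρ : PointedCone ℚ (κ → ℚ)} (hρ : ρ ∈ Δ.cones) {x : κ → ℚ}
    (hx : x ∈ σ) :
    0 ≤ (∑ g ∈ hGfin.toFinset, m (ρ.map (g : (κ → ℚ) →ₗ[ℚ] (κ → ℚ))) ᵥ* LinearMap.toMatrix' (g : (κ → ℚ) →ₗ[ℚ] (κ → ℚ)))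
      ⬝ᵥ x := by
  rw [symm_dotProduct]
  refine Finset.sum_nonneg fun g hg => ?_
  have hg' : g ∈ G := hGfin.mem_toFinset.mp hg
  exact hnn _ (hGΔ g hg' ρ hρ) _ (hGσ g hg' x hx)

/-- **Vanishing on a `G`-stable family of cones is inherited** (in the ladder: the proper faces of the isolated cone, permuted
by `G`): if every piece vanishes on the points of its cone lying in a member of the family `F`, so does every averaged piece.
[folklore] -/
theorem symm_eq_zero {F : Set (PointedCone ℚ (κ → ℚ))}
    (hGF : ∀ g ∈ G, ∀ τ ∈ F, τ.map (g : (κ → ℚ) →ₗ[ℚ] (κ → ℚ)) ∈ F)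
    (hGΔ : ∀ g ∈ G, ∀ ρ ∈ Δ.cones, ρ.map (g : (κ → ℚ) →ₗ[ℚ] (κ → ℚ)) ∈ Δ.cones)
    (hvan : ∀ τ ∈ F, ∀ ρ ∈ Δ.cones, ∀ x ∈ ρ, x ∈ τ → m ρ ⬝ᵥ x = 0)
    {τ : PointedCone ℚ (κ → ℚ)} (hτ : τ ∈ F) {ρ : PointedCone ℚ (κ → ℚ)} (hρ : ρ ∈ Δ.cones) {x : κ → ℚ} (hxρ : x ∈ ρ)
    (hxτ : x ∈ τ) :
    (∑ g ∈ hGfin.toFinset, m (ρ.map (g : (κ → ℚ) →ₗ[ℚ] (κ → ℚ))) ᵥ* LinearMap.toMatrix' (g : (κ → ℚ) →ₗ[ℚ] (κ → ℚ)))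
      ⬝ᵥ x = 0 := by
  rw [symm_dotProduct]
  refine Finset.sum_eq_zero fun g hg => ?_
  have hg' : g ∈ G := hGfin.mem_toFinset.mp hg
  exact hvan _ (hGF g hg' τ hτ) _ (hGΔ g hg' ρ hρ) _ (PointedCone.mem_map.mpr ⟨x, hxρ, rfl⟩)
    (PointedCone.mem_map.mpr ⟨x, hxτ, rfl⟩)

/-- **Positivity somewhere is inherited** when the pieces are non-negative on their own cones and `1 ∈ G`. [folklore] -/
theorem symm_pos (hG1 : LinearEquiv.refl ℚ (κ → ℚ) ∈ G)
    (hGΔ : ∀ g ∈ G, ∀ ρ ∈ Δ.cones, ρ.map (g : (κ → ℚ) →ₗ[ℚ] (κ → ℚ)) ∈ Δ.cones)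
    (hnn : ∀ ρ ∈ Δ.cones, ∀ x ∈ ρ, 0 ≤ m ρ ⬝ᵥ x) {ρ : PointedCone ℚ (κ → ℚ)} (hρ : ρ ∈ Δ.cones) {x : κ → ℚ}
    (hxρ : x ∈ ρ) (hpos : 0 < m ρ ⬝ᵥ x) :
    0 < (∑ g ∈ hGfin.toFinset, m (ρ.map (g : (κ → ℚ) →ₗ[ℚ] (κ → ℚ))) ᵥ* LinearMap.toMatrix' (g : (κ → ℚ) →ₗ[ℚ] (κ → ℚ)))
      ⬝ᵥ x := by
  rw [symm_dotProduct]
  have h1 : LinearEquiv.refl ℚ (κ → ℚ) ∈ hGfin.toFinset := hGfin.mem_toFinset.mpr hG1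
  have hρ1 : ρ.map ((LinearEquiv.refl ℚ (κ → ℚ) : (κ → ℚ) ≃ₗ[ℚ] (κ → ℚ)) : (κ → ℚ) →ₗ[ℚ] (κ → ℚ)) = ρ := by
    ext y; simp
  refine lt_of_lt_of_le ?_ (Finset.single_le_sum (fun g hg => ?_) h1)
  · rw [hρ1]; simpa using hpos
  · have hg' : g ∈ G := hGfin.mem_toFinset.mp hg
    exact hnn _ (hGΔ g hg' ρ hρ) _ (PointedCone.mem_map.mpr ⟨x, hxρ, rfl⟩)

end Symm

/-! ## Appendix (leafhand-4 g6): the invariant ORDER FUNCTION of invariant support data -/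

section OrderFunction

variable {Δ : Fan ℚ (κ → ℚ)} {G : Set ((κ → ℚ) ≃ₗ[ℚ] (κ → ℚ))} {m : PointedCone ℚ (κ → ℚ) → (κ → ℚ)}

omit [DecidableEq κ] in
/-- **The order function of `G`-invariant tight strict support data is a `G`-invariant function.** If `m` is tight strict
support data on a `G`-stable fan with `m (h ρ) · (h x) = m ρ · x` (e.g. the averaged data of `isStrictSupport_symm`,
`symm_dotProduct_map`), then there is ONE function `f` on the ambient space with `f = m ρ · _` on every cone `ρ` and
`f (h x) = f x` on the support for every `h ∈ G` — the `π`-invariant order function `f` consumed by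
`…SafeRayCentreStable.map_span_centre_le_span_centre`. [cite: KempfEtAl1973, Ch. I §2 Thm. 10] -/
theorem exists_invariant_orderFunction (hm : Δ.IsStrictSupport m)
    (hGΔ : ∀ g ∈ G, ∀ ρ ∈ Δ.cones, ρ.map (g : (κ → ℚ) →ₗ[ℚ] (κ → ℚ)) ∈ Δ.cones)
    (hinv : ∀ h ∈ G, ∀ (ρ : PointedCone ℚ (κ → ℚ)) (x : κ → ℚ),
      m (ρ.map (h : (κ → ℚ) →ₗ[ℚ] (κ → ℚ))) ⬝ᵥ h x = m ρ ⬝ᵥ x) :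
    ∃ f : (κ → ℚ) → ℚ, (∀ ρ ∈ Δ.cones, ∀ x ∈ ρ, f x = m ρ ⬝ᵥ x) ∧
      ∀ h ∈ G, ∀ x ∈ Δ.support, f (h x) = f x := by
  classical
  -- on the support, pair with the piece of SOME cone containing the point; `0` elsewhere
  let f : (κ → ℚ) → ℚ := fun x =>
    if hx : x ∈ Δ.support then m (Classical.choose (Fan.mem_support.mp hx)) ⬝ᵥ x else 0
  have hf : ∀ ρ ∈ Δ.cones, ∀ x ∈ ρ, f x = m ρ ⬝ᵥ x := by
    intro ρ hρ x hx
    have hxs : x ∈ Δ.support := Fan.mem_support.mpr ⟨ρ, hρ, hx⟩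
    obtain ⟨hρ', hxρ'⟩ := Classical.choose_spec (Fan.mem_support.mp hxs)
    simp only [f, dif_pos hxs]
    exact hm.eq_of_mem_of_mem hρ' hρ hxρ' hx
  refine ⟨f, hf, fun h hh x hx => ?_⟩
  obtain ⟨ρ, hρ, hxρ⟩ := Fan.mem_support.mp hx
  have hhx : h x ∈ ρ.map (h : (κ → ℚ) →ₗ[ℚ] (κ → ℚ)) := PointedCone.mem_map.mpr ⟨x, hxρ, rfl⟩
  rw [hf _ (hGΔ h hh ρ hρ) _ hhx, hf ρ hρ x hxρ]
  exact hinv h hh ρ x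

end OrderFunction

end Summit.ResolutionOfSingularities.ResolutionOfSingularities.Theorems.FRationalResolution.InvariantSupport
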